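import Summits.Ventures.PercRepro.Night2FatDegLarge
import Summits.Ventures.PercRepro.Night2FatDegWitness

/-!
# night-2: the singly degenerate regime for `N ≥ 9` — every lossy basis pair

* **`basis_pair_fair_fat_deg_of_nine_le'`**: the variant of `basis_pair_fair_fat_deg_of_nine_le` with TWO side points
  and ONE free point (the family «`Y ∋ f` and `Y` meets `{y₃, y₃′}`» has the same count);
* **`basis_pair_fair_fat_deg_nine_le`**: with the witnesses of `exists_side_and_free_deg`, EVERY lossy basis pair of
  the singly degenerate regime with `N ≥ 9` has the fair share.
Paper `proofs/NIGHT-2-g35.md` §3.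
-/

namespace PercRepro.Shadow

open PercRepro.ThmH PercRepro.PerFlat

variable {α : Type*} [DecidableEq α] {M : Matroid α} [M.Finite] {G : Finset α}

/-- **The fair share of a lossy basis pair with `N ≥ 9`, two side points and one free point.** -/
theorem basis_pair_fair_fat_deg_of_nine_le' (hG : G ∈ flatsQ M (5 + 1)) (hd : (gr M \ G).card = 2)
    (hk : kColoops M G = 1) (hs : ∀ e ∈ gr M, ∀ f ∈ gr M, e ≠ f → rkN M {e, f} = 2)
    (hl : ∀ e ∈ gr M, M.Indep {e}) (hfat : (fatClosures M 5 G 2).card ≤ 1) {B₀ : Finset α}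
    (hB₀ : B₀ ∈ thinMembers M 5 G) {w₀ x : α} (hD : G \ clF M B₀ = {w₀, x}) (hne : w₀ ≠ x) {R₁ : Finset α}
    (hR₁V : R₁ ⊆ (G \ coloops M G) \ {w₀, x}) (hR₁2 : rkN M R₁ = 2) (hR₁3 : 3 ≤ R₁.card) {c₂ c₃ : α}
    (hc₂V : c₂ ∈ (G \ coloops M G) \ {w₀, x}) (hc₃V : c₃ ∈ (G \ coloops M G) \ {w₀, x})
    (hc₂ : c₂ ∉ clF M R₁) (hc₃ : c₃ ∉ clF M (insert c₂ R₁))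
    (hcover : ∀ e ∈ (G \ coloops M G) \ {w₀, x}, e ∈ clF M (insert c₂ R₁) ∨ e ∈ clF M (insert c₃ R₁))
    (hnd₂ : 3 ≤ rkN M (((G \ coloops M G) \ {w₀, x}).filter
      (fun e => e ∈ clF M (insert c₂ R₁) ∧ e ∉ clF M R₁)))
    {B : Finset α} (hB : B ∈ thinMembers M 5 G) (hnP : ¬ bigP M G B) {z : α} (hz : z ∈ G \ clF M B)
    (hl0 : loss M 5 G B z ≠ 0) (hw₀ : w₀ ∈ insert z B) (hx : x ∉ insert z B) (hN : 9 ≤ (G \ insert z B).card)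
    {y₃ y₃' : α} (hy₃ : y₃ ∈ (G \ insert z B).erase x) (hy₃3 : y₃ ∈ clF M (insert c₃ R₁)) (hy₃L : y₃ ∉ clF M R₁)
    (hy₃' : y₃' ∈ (G \ insert z B).erase x) (hy₃'3 : y₃' ∈ clF M (insert c₃ R₁)) (hy₃'L : y₃' ∉ clF M R₁)
    (hne₃ : y₃ ≠ y₃')
    {f : α} (hf : f ∈ (G \ insert z B).erase x)
    (hfM : f ∉ clF M (((G \ coloops M G) \ {w₀, x}).filter
      (fun e => e ∈ clF M (insert c₃ R₁) ∧ e ∉ clF M R₁)))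
    (hf' : ∀ a ∈ (insert z B \ coloops M G).erase w₀, ∀ b ∈ (insert z B \ coloops M G).erase w₀, a ≠ b →
      f ∈ clF M {a, b} → rkN M (insert w₀ (insert x {a, b})) ≤ 3 →
      4 ≤ rkN M ({a, b} ∪ ((G \ coloops M G) \ {w₀, x}).filter
        (fun e => e ∈ clF M (insert c₃ R₁) ∧ e ∉ clF M R₁))) :
    loss M 5 G B z ≤ rhoL M 5 G B z * lossIncomeH M 5 G (bigP M G) (dshGT2 M 5 G) B z := by
  have hd' : (gr M \ G).card ≤ 5 := by omega
  have hGg : G ⊆ gr M := (mem_flatsQ.1 hG).1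
  have hxG : x ∈ G \ insert z B := by
    refine Finset.mem_sdiff.2 ⟨?_, hx⟩
    have : x ∈ G \ clF M B₀ := by
      rw [hD]
      exact Finset.mem_insert_of_mem (Finset.mem_singleton_self _)
    exact (Finset.mem_sdiff.1 this).1
  set W' := (G \ insert z B).erase x with hW'
  have hW'c : W'.card + 1 = (G \ insert z B).card := by
    rw [hW', Finset.card_erase_of_mem hxG]
    have : 0 < (G \ insert z B).card := Finset.card_pos.2 ⟨x, hxG⟩
    omega
  -- the side points are in `clF M`, hence differ from `f`
  have hKQ : coloops M G ⊆ insert z B :=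
    (coloops_subset_of_mem_thinMembers hG hd' hB).trans (Finset.subset_insert _ _)
  have hside : ∀ y ∈ W', y ∈ clF M (insert c₃ R₁) → y ∉ clF M R₁ →
      y ∈ clF M (((G \ coloops M G) \ {w₀, x}).filter (fun e => e ∈ clF M (insert c₃ R₁) ∧ e ∉ clF M R₁)) := by
    intro y hy hy3 hyL
    have hyx : y ≠ x := (Finset.mem_erase.1 hy).1
    have hyTQ : y ∈ G \ insert z B := Finset.mem_of_mem_erase hy
    have hyV : y ∈ (G \ coloops M G) \ {w₀, x} := by
      rw [Finset.mem_sdiff, Finset.mem_sdiff, Finset.mem_insert, Finset.mem_singleton]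
      refine ⟨⟨(Finset.mem_sdiff.1 hyTQ).1, fun h => (Finset.mem_sdiff.1 hyTQ).2 (hKQ h)⟩, ?_⟩
      rintro (rfl | rfl)
      · exact (Finset.mem_sdiff.1 hyTQ).2 hw₀
      · exact hyx rfl
    exact subset_clF_of_subset_gr (fun e he => hGg (Finset.mem_sdiff.1 (Finset.mem_sdiff.1
      (Finset.mem_filter.1 he).1).1).1) (Finset.mem_filter.2 ⟨hyV, hy3, hyL⟩)
  have hfy₃ : f ≠ y₃ := by
    rintro rfl
    exact hfM (hside f hy₃ hy₃3 hy₃L)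
  have hfy₃' : f ≠ y₃' := by
    rintro rfl
    exact hfM (hside f hy₃' hy₃'3 hy₃'L)
  set U : Finset α := {f} with hU
  set V : Finset α := {y₃, y₃'} with hV
  have hUW : U ⊆ W' := Finset.singleton_subset_iff.2 hf
  have hVW : V ⊆ W' := Finset.insert_subset hy₃ (Finset.singleton_subset_iff.2 hy₃')
  have hUV : Disjoint U V := by
    rw [hU, hV, Finset.disjoint_singleton_left, Finset.mem_insert, Finset.mem_singleton, not_or]
    exact ⟨hfy₃, hfy₃'⟩
  have hUc : U.card = 1 := Finset.card_singleton _
  have hVc : V.card = 2 := Finset.card_pair hne₃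
  set P : Finset α → Prop := fun Y => (Y ∩ U).Nonempty ∧ ((Y ∩ V).Nonempty ∨ 2 ≤ (Y ∩ U).card) with hP
  have hPunload : ∀ T ∈ tgtSets M 5 G B z, x ∈ T → P ((T \ insert z B).erase x) →
      dload M 5 G (bigP M G) (dshGT2 M 5 G) T = 0 := by
    intro T hT hxT hPY
    obtain ⟨⟨u, hu⟩, hrest⟩ := hPY
    rw [Finset.mem_inter, hU, Finset.mem_singleton] at hu
    obtain ⟨huY, rfl⟩ := hu
    rcases hrest with ⟨y, hy⟩ | h2
    · rw [Finset.mem_inter, hV, Finset.mem_insert, Finset.mem_singleton] at hy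
      obtain ⟨hyY, rfl | rfl⟩ := hy
      · exact dload_eq_zero_of_side_free_deg hG hd hk hs hl hfat hB₀ hD hne hR₁V hR₁2 hR₁3 hc₂V hc₃V hc₂ hc₃
          hcover hnd₂ hB hnP hz hw₀ hx hT hxT hyY hy₃3 hy₃L huY hfM hf'
      · exact dload_eq_zero_of_side_free_deg hG hd hk hs hl hfat hB₀ hD hne hR₁V hR₁2 hR₁3 hc₂V hc₃V hc₂ hc₃
          hcover hnd₂ hB hnP hz hw₀ hx hT hxT hyY hy₃'3 hy₃'L huY hfM hf'
    · exfalso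
      have := Finset.card_le_card (Finset.inter_subset_right (s₁ := (T \ insert z B).erase x) (s₂ := U))
      rw [hUc] at this
      omega
  have hcount : ∀ k, W'.card.choose k ≤ ((W'.powersetCard k).filter P).card + (W'.card - 1).choose k +
      (W'.card - 3).choose (k - 1) := by
    intro k
    have := choose_le_card_filter_side_family W' U V hUW hVW hUV k
    rw [hUc, hVc] at this
    rw [show W'.card - 1 - 2 = W'.card - 3 by omega] at this
    simpa using this
  have hlev : ∀ j, 1 ≤ j → (((W'.powersetCard (j - 1)).filter P).card : ℚ) * fatTerm j (11 / 18) ≤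
      ∑ T ∈ ((tgtSets M 5 G B z).filter
        (fun T => x ∈ T ∧ dload M 5 G (bigP M G) (dshGT2 M 5 G) T = 0)).filter
        (fun T => (T \ insert z B).card = j),
        capS M 5 G T / ((221 / 360 : ℚ) * ((2 * ((T \ coloops M G).card - 2).choose 4 : ℕ) : ℚ)) := by
    intro j hj
    have h1 := fat_count_level_ge_family hG hd hk hB hnP hz hxG P hj (fun T hT hxT _ hPY => hPunload T hT hxT hPY)
    have h2 := fatTerm_le_fatTerm_if' j (G \ insert z B).card
    have h0 : (0 : ℚ) ≤ (((W'.powersetCard (j - 1)).filter P).card : ℚ) := by positivity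
    calc (((W'.powersetCard (j - 1)).filter P).card : ℚ) * fatTerm j (11 / 18)
        ≤ (((W'.powersetCard (j - 1)).filter P).card : ℚ) *
          fatTerm j (if (G \ insert z B).card - j ≤ 3 then 1 else 11 / 18) := mul_le_mul_of_nonneg_left h2 h0
      _ ≤ _ := h1
  have hg0 : ∀ T ∈ (tgtSets M 5 G B z).filter
      (fun T => x ∈ T ∧ dload M 5 G (bigP M G) (dshGT2 M 5 G) T = 0),
      0 ≤ capS M 5 G T / ((221 / 360 : ℚ) * ((2 * ((T \ coloops M G).card - 2).choose 4 : ℕ) : ℚ)) :=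
    fun T _ => div_nonneg (capS_nonneg' hG hd' T) (by positivity)
  apply basis_pair_fair_of_fat_count_sum hG hd hk hs hl hfat hB₀ hD hne hB hnP hz hl0 hw₀ hx
  have hsum := sum_levels_le_sum hg0 (fun T => (T \ insert z B).card) {1, 3, 4, 5, 6, 7, 8, 9}
  rw [Finset.sum_insert (by decide), Finset.sum_insert (by decide), Finset.sum_insert (by decide),
    Finset.sum_insert (by decide), Finset.sum_insert (by decide), Finset.sum_insert (by decide),
    Finset.sum_insert (by decide), Finset.sum_singleton] at hsum
  have hl1 := fat_count_level_ge' hG hd hk hB hnP hz hxG (j := 1) (by norm_num)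
    (fun T hT _ h1 => dload_eq_zero_of_card_sdiff_le_six hG hd hk hs hl
      (by rw [card_sdiff_coloops_eq_level_add_five hG hd hk hB hnP hz hT, h1]))
  have hc1 : (if (G \ insert z B).card - 1 ≤ 3 then (1 : ℚ) else 11 / 18) = 11 / 18 := by
    rw [if_neg (by omega)]
  rw [hc1] at hl1
  simp only [Nat.sub_self, Nat.choose_zero_right, Nat.cast_one, one_mul] at hl1
  have hl3 := hlev 3 (by norm_num)
  have hl4 := hlev 4 (by norm_num)
  have hl5 := hlev 5 (by norm_num)
  have hl6 := hlev 6 (by norm_num)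
  have hl7 := hlev 7 (by norm_num)
  have hl8 := hlev 8 (by norm_num)
  have hl9 := hlev 9 (by norm_num)
  have hnum := numeric_deg_large W'.card (by omega)
    ((W'.powersetCard 2).filter P).card ((W'.powersetCard 3).filter P).card ((W'.powersetCard 4).filter P).card
    ((W'.powersetCard 5).filter P).card ((W'.powersetCard 6).filter P).card ((W'.powersetCard 7).filter P).card
    ((W'.powersetCard 8).filter P).card (hcount 2) (hcount 3) (hcount 4) (hcount 5) (hcount 6) (hcount 7)
    (hcount 8)
  simp only [show (3 : ℕ) - 1 = 2 by rfl, show (4 : ℕ) - 1 = 3 by rfl, show (5 : ℕ) - 1 = 4 by rfl,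
    show (6 : ℕ) - 1 = 5 by rfl, show (7 : ℕ) - 1 = 6 by rfl, show (8 : ℕ) - 1 = 7 by rfl,
    show (9 : ℕ) - 1 = 8 by rfl] at hl3 hl4 hl5 hl6 hl7 hl8 hl9
  linarith

/-- **THE SINGLY DEGENERATE REGIME FOR `N ≥ 9`: every lossy basis pair has the fair share.** -/
theorem basis_pair_fair_fat_deg_nine_le (hG : G ∈ flatsQ M (5 + 1)) (hd : (gr M \ G).card = 2)
    (hk : kColoops M G = 1) (hs : ∀ e ∈ gr M, ∀ f ∈ gr M, e ≠ f → rkN M {e, f} = 2)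
    (hl : ∀ e ∈ gr M, M.Indep {e}) (hfat : (fatClosures M 5 G 2).card ≤ 1) {B₀ : Finset α}
    (hB₀ : B₀ ∈ thinMembers M 5 G) {w₀ x : α} (hD : G \ clF M B₀ = {w₀, x}) (hne : w₀ ≠ x) {R₁ : Finset α}
    (hR₁V : R₁ ⊆ (G \ coloops M G) \ {w₀, x}) (hR₁2 : rkN M R₁ = 2) (hR₁3 : 3 ≤ R₁.card)
    (hcop : rkN M (insert w₀ (insert x R₁)) ≤ 3) {c₂ c₃ : α}
    (hc₂V : c₂ ∈ (G \ coloops M G) \ {w₀, x}) (hc₃V : c₃ ∈ (G \ coloops M G) \ {w₀, x})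
    (hc₂ : c₂ ∉ clF M R₁) (hc₃ : c₃ ∉ clF M (insert c₂ R₁))
    (hcover : ∀ e ∈ (G \ coloops M G) \ {w₀, x}, e ∈ clF M (insert c₂ R₁) ∨ e ∈ clF M (insert c₃ R₁))
    (hnd₂ : 3 ≤ rkN M (((G \ coloops M G) \ {w₀, x}).filter
      (fun e => e ∈ clF M (insert c₂ R₁) ∧ e ∉ clF M R₁)))
    (hdeg₃ : rkN M (((G \ coloops M G) \ {w₀, x}).filter
      (fun e => e ∈ clF M (insert c₃ R₁) ∧ e ∉ clF M R₁)) ≤ 2)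
    {B : Finset α} (hB : B ∈ thinMembers M 5 G) (hnP : ¬ bigP M G B) {z : α} (hz : z ∈ G \ clF M B)
    (hl0 : loss M 5 G B z ≠ 0) (hw₀ : w₀ ∈ insert z B) (hx : x ∉ insert z B) (hN : 9 ≤ (G \ insert z B).card) :
    loss M 5 G B z ≤ rhoL M 5 G B z * lossIncomeH M 5 G (bigP M G) (dshGT2 M 5 G) B z := by
  obtain ⟨y₃, hy₃, ⟨hy₃3, hy₃L⟩, hcase⟩ := exists_side_and_free_deg hG hd hk hs hfat hB₀ hD hne hR₁V hR₁2 hR₁3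
    hcop hc₂V hc₃V hc₂ hc₃ hcover hnd₂ hdeg₃ hB hnP hz hw₀ hx
  rcases hcase with ⟨f₁, hf₁, f₂, hf₂, hf₁₂, ⟨hf₁M, hf₁'⟩, ⟨hf₂M, hf₂'⟩⟩ |
    ⟨y₃', hy₃', hyy, ⟨hy₃'3, hy₃'L⟩, f, hf, hfM, hf'⟩
  · exact basis_pair_fair_fat_deg_of_nine_le hG hd hk hs hl hfat hB₀ hD hne hR₁V hR₁2 hR₁3 hc₂V hc₃V hc₂ hc₃
      hcover hnd₂ hB hnP hz hl0 hw₀ hx hN hy₃ hy₃3 hy₃L hf₁ hf₂ hf₁₂ hf₁M hf₂M hf₁' hf₂'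
  · exact basis_pair_fair_fat_deg_of_nine_le' hG hd hk hs hl hfat hB₀ hD hne hR₁V hR₁2 hR₁3 hc₂V hc₃V hc₂ hc₃
      hcover hnd₂ hB hnP hz hl0 hw₀ hx hN hy₃ hy₃3 hy₃L hy₃' hy₃'3 hy₃'L (Ne.symm hyy) hf hfM hf'

end PercRepro.Shadow
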